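import Summits.QuantumFields.BalabanUV.Beta.EriceRemainderEnclosureHistoryAutonomyComparisonNonlinearLightBase

/-!
# EriceRemainderEnclosureHistoryAutonomyComparisonNonlinearLight — (E120c) **COMPARISON AT ANY SIZE FOR EVERY ISOTONE EXCESS ALONG ORBITS THAT ARE LIGHT BELOW THEIR
# SECOND ROW.**  `B u = β₀ + Σ_{k<K} L_k·u_k` (`β₀ > 0`, `L ≥ 0`, `L_0 = 0`; the profile, the range `K` and all sizes ARBITRARY); `B′ ≥ B` on the box with a modulus
# `M′` and an ISOTONE excess `B′ − B` of ANY size and ANY steepness (no modulus condition on the excess).  Along a base orbit `h` with **`T(m) = Σ_{1≤k<K} k·L_kh_{m+k}³∕2 ≤ 1`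
# for every `m ≥ 2`** (the rows below the second are light; every configuration the cell has computed has `T ≤ 0.85` at EVERY row): (**`steps_nonneg_gauge_light`**) the
# step quantities `X_m = B′(S′h_m) − B(S h_m)` are NON-NEGATIVE with `X_m·h_m²` NON-INCREASING; (**`effective_le_light`**) `B(S y) ≤ B′(S′y)`;
# (**`le_of_isotone_excess_light`**, family-free) ANY box solutions `h`, `h′` of `B`, `B′` from one pin satisfy `h′ ≤ h` at EVERY scale.  Together with (E119d)
# (`ME·γ ≤ β₀∕5`, no load condition) and (E119e) (affine excesses) this is conjecture (E58′) for every isotone excess up to the light-below condition on the base orbit.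
#
# THE PROOF is (E119d)'s row induction with excess modulus `0`, the row inequality supplied by (E120a) `row_ge_light`: within a configuration the level gap drops between
# consecutive depths by at most `F·δ` as soon as the deeper row is light ((E120a) `conf_incr_ge_light` — exact increment = excess seen − affine drop, deeper gaps exceed the
# current one by at most the excess accumulated in between), so no pin sensitivity and no modulus enter; base = deep region ((E118c) `exists_base_depth`, (E49j)
# `effective_le_of_small_pin`, (E120b) `base_gauge_light`).

Cell `pub-balaban`, β-function sub-cell, BINDER row D4 «RemainderConst leaves for Bałaban's split» (`HOME/BINDER-OWNERS.md`; owner lineage `b2b-balaban-beta-an4`;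
this file by co-owner #2 lineage `b2b-balaban-beta-d4-p2`, generation 98), β-FLOW TEAM duty (1), FREEZE (0) honoured (def-free; imports (E120b) `…NonlinearLightBase`; uses
(E120a∕b) `row_ge_light` ∕ `base_gauge_light`, (E119a∕b∕d) `flow_damped_age_ge_two_le_slack` ∕ `excess_facts` ∕ `cmp_of_steps_nonneg` ∕ `excess_orbit_antitone` ∕ `defect_mod_le` ∕
`conf_window_le_mod`, (E118a∕c∕e) `affine_facts` ∕ `exists_base_depth` ∕ `gauge_chain`, (E116c) `flow_age_one_le`, (E116b) `flow_budget_le`, (E49j) `effective_le_of_small_pin`,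
(E49k) `family_le_of_orbit`, (E39) `exists_memFlow_zm`, (E43b) `memFlow_unique_of_monotone_zm`, (E48a) `family_mem` ∕ `family_tail_eq` ∕ `family_zero` BY NAME; the proofs
are (E119d)'s, re-run — nothing else restated).

HONEST FRAMING (page 1, verbatim and binding).  *"Discharging BetaPertH makes Bałaban's UV stability UNCONDITIONAL — a real constructive-QFT result; it is
NOT the continuum limit and NOT the Clay problem."*  THIS FILE DISCHARGES NOTHING OF THE KIND.  Elementary real analysis about ABSTRACT functionals on a box
]0,γ]^ℕ with displayed floors, moduli, profiles and signs — hypotheses of a census, not facts; the form, signs, ages and moments of Bałaban's (1.22) limit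
functional are NOT PRINTED ([I] p. 298; GAPS G-t4-U2-1∕-2) and NOT asserted.  Row D4 class UNCHANGED (critical-path width 0; instance 0∕1; D4 DISCHARGE NO
DATE).  HONEST DEPENDENCY: continuum YM on T⁴ ⇐ BetaPertH ∧ nine spine estimates (0/9 proved); BetaPertH ⇐ (D1) ∧ (D4) ∧ CAP+tail; G-an2-4 gates asym, D1
and NE2/3/4.  NOT CLAIMED: orbits with a heavy row `T(m) > 1`, `m ≥ 2` (then only (E119d∕e) apply); Markov weight `L_0 > 0`; anything printed — NOT B12 Thm 2, NOT
BetaPertH, NOT continuum, NOT Clay.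

WHAT IS PROVED ([folklore]; 0 `def`, 0 sorry).  §1 **`gauge_step_light`**.  §2 **`steps_nonneg_gauge_light`**.  §3 **`effective_le_light`**, **`le_of_isotone_excess_light`**.
-/

noncomputable section
open Finset Set

namespace Summit.QuantumFields.BalabanUV.Beta.EriceRemainderEnclosureHistoryAutonomyComparisonNonlinearLight

open Literature.MathematicalPhysics.QuantumFieldTheory.Balaban1983to89
open Literature.MathematicalPhysics.QuantumFieldTheory.Balaban1983to89.T4BetaStationary
open Literature.MathematicalPhysics.QuantumFieldTheory.Balaban1983to89.T4BetaFlowWellPosed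
open Summit.QuantumFields.BalabanUV.Beta.EriceRemainderEnclosureHistoryAutonomyOrder (family_mem family_tail_eq family_zero strictAnti_of_memFlow)
open Summit.QuantumFields.BalabanUV.Beta.EriceRemainderEnclosureHistoryAutonomyComparisonExcess (effective_le_of_small_pin)
open Summit.QuantumFields.BalabanUV.Beta.EriceRemainderEnclosureHistoryAutonomyComparisonIsotoneExcess (family_le_of_orbit)
open Summit.QuantumFields.BalabanUV.Beta.EriceRemainderEnclosureHistoryAutonomyExistence (exists_memFlow_zm)
open Summit.QuantumFields.BalabanUV.Beta.EriceRemainderEnclosureHistoryAutonomyMonotoneGeneral (memFlow_unique_of_monotone_zm)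
open Summit.QuantumFields.BalabanUV.Beta.EriceRemainderEnclosureHistoryAutonomyComparisonDropBound (levelGap_le_sum_step)
open Summit.QuantumFields.BalabanUV.Beta.EriceRemainderEnclosureHistoryAutonomyComparisonAgeCompositionHeatingCriterionFlow (flow_budget_le)
open Summit.QuantumFields.BalabanUV.Beta.EriceRemainderEnclosureHistoryAutonomyComparisonAgeCompositionLevelGaugePrep (flow_age_one_le)
open Summit.QuantumFields.BalabanUV.Beta.EriceRemainderEnclosureHistoryAutonomyComparisonAgeCompositionDampedLevelGaugePrep (flow_damped_age_ge_two_le)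
open Summit.QuantumFields.BalabanUV.Beta.EriceRemainderEnclosureHistoryAutonomyComparisonNonlinearRowPrep (affine_facts)
open Summit.QuantumFields.BalabanUV.Beta.EriceRemainderEnclosureHistoryAutonomyComparisonNonlinearLevelGaugePrep (exists_base_depth)
open Summit.QuantumFields.BalabanUV.Beta.EriceRemainderEnclosureHistoryAutonomyComparisonNonlinearLevelGauge (gauge_chain)
open Summit.QuantumFields.BalabanUV.Beta.EriceRemainderEnclosureHistoryAutonomyComparisonNonlinearSlack (flow_damped_age_ge_two_le_slack)
open Summit.QuantumFields.BalabanUV.Beta.EriceRemainderEnclosureHistoryAutonomyComparisonNonlinearModulusPrep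
  (excess_facts cmp_of_steps_nonneg excess_orbit_antitone defect_mod_le)
open Summit.QuantumFields.BalabanUV.Beta.EriceRemainderEnclosureHistoryAutonomyComparisonNonlinearModulus (conf_window_le_mod)
open Summit.QuantumFields.BalabanUV.Beta.EriceRemainderEnclosureHistoryAutonomyComparisonNonlinearLightPrep (row_ge_light)
open Summit.QuantumFields.BalabanUV.Beta.EriceRemainderEnclosureHistoryAutonomyComparisonNonlinearLightBase (base_gauge_light)

variable {B B' : (ℕ → ℝ) → ℝ} {γ β₀ M' : ℝ} {L : ℕ → ℝ} {K : ℕ} {S S' : ℝ → ℕ → ℝ}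

/-! ## §1 The step of the row induction -/

set_option maxHeartbeats 800000 in
/-- **THE STEP OF THE ROW INDUCTION (isotone excess with `(0:ℝ)·γ ≤ β₀∕5`).**  If `X_m ≥ 0` and `X_{m+1}h_{m+1}² ≤ X_mh_m²` for all `m ≥ n+1`, then
`X_{n+1}h_{n+1}² ≤ X_nh_n²`: (E118b) `row_ge` + `conf_window_le_mod` + (E119a) `flow_damped_age_ge_two_le_slack` + (E119b) `defect_mod_le` + (E116c) `flow_age_one_le` +
(E116b) `flow_budget_le`; the excess difference `e_n − e_{n+1} ≥ 0` is dropped. [folklore] -/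
theorem gauge_step_light (hBaff : ∀ u, SeqBox γ u → B u = β₀ + ∑ k ∈ range K, L k * u k) (hL : ∀ k, 0 ≤ L k) (hL0 : L 0 = 0) (hβ : 0 < β₀)
    (hB' : ∀ u u' : ℕ → ℝ, SeqBox γ u → SeqBox γ u' → ∀ D : ℝ, (∀ j, |u j - u' j| ≤ D) → |B' u - B' u'| ≤ M' * D) (hM' : 0 ≤ M')
    (hexc : ∀ u, SeqBox γ u → B u ≤ B' u)
    (hDmono : ∀ u v : ℕ → ℝ, SeqBox γ u → SeqBox γ v → (∀ j, u j ≤ v j) → B' u - B u ≤ B' v - B v)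
    (hS : ∀ p, 0 < p → p ≤ γ → SeqBox γ (S p) ∧ MemFlow B p (S p))
    (huniq : ∀ p, 0 < p → p ≤ γ → ∀ u u' : ℕ → ℝ, SeqBox γ u → SeqBox γ u' → MemFlow B p u → MemFlow B p u' → u = u')
    (hS' : ∀ p, 0 < p → p ≤ γ → SeqBox γ (S' p) ∧ MemFlow B' p (S' p))
    (huniq' : ∀ p, 0 < p → p ≤ γ → ∀ u u' : ℕ → ℝ, SeqBox γ u → SeqBox γ u' → MemFlow B' p u → MemFlow B' p u' → u = u')
    {y : ℝ} (hy : 0 < y) (hyγ : y ≤ γ) (n : ℕ) (hT : ∀ m, n + 2 ≤ m → ∑ k ∈ Ico 1 K, (k : ℝ) * (L k * S y (m + k) ^ 3 / 2) ≤ 1)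
    (hX : ∀ m, n + 1 ≤ m → 0 ≤ B' (S' (S y m)) - B (S (S y m)))
    (hg : ∀ m, n + 1 ≤ m → (B' (S' (S y (m + 1))) - B (S (S y (m + 1)))) * S y (m + 1) ^ 2 ≤ (B' (S' (S y m)) - B (S (S y m))) * S y m ^ 2) :
    (B' (S' (S y (n + 1))) - B (S (S y (n + 1)))) * S y (n + 1) ^ 2 ≤ (B' (S' (S y n)) - B (S (S y n))) * S y n ^ 2 := by
  obtain ⟨hmono', hlo'⟩ := excess_facts hBaff hL hβ hexc hDmono
  obtain ⟨hmono, hlo, hdom, _⟩ := affine_facts hBaff hL hβ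
  have hh := (hS y hy hyγ).1
  have hf := (hS y hy hyγ).2
  have hpos : ∀ j, 0 < S y j := fun j => (hh j).1
  have hcmp := cmp_of_steps_nonneg hBaff hL hβ hB' hM' hexc hDmono hS huniq hS' huniq' hy hyγ n hX
  set X1 : ℝ := B' (S' (S y (n + 1))) - B (S (S y (n + 1))) with hX1def
  have hX10 : 0 ≤ X1 := hX (n + 1) le_rfl
  have hΔe := (excess_orbit_antitone hBaff hL hβ hB' hM' hexc hDmono hS hS' huniq' hy hyγ n).2
  have hME : (0 : ℝ) ≤ 0 := le_rfl
  have hMEγ : (0 : ℝ) * γ ≤ β₀ / 5 := by rw [zero_mul]; positivity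
  have hrow := row_ge_light hBaff hL hL0 hβ hmono' hβ hB' hM' hlo' hexc hDmono hS huniq hS' huniq' hy hyγ n hcmp hT
  have hq1 := family_mem hS hy hyγ (n + 1)
  have hwin := conf_window_le_mod hBaff hL hβ hB' hM' hexc hDmono hS huniq hS' huniq' hy hyγ n (hcmp (n + 1) (by omega)) hg
  -- per-age costs
  have hcost : ∑ k ∈ Ico 1 K, L k * S y (n + k) ^ 3 / 2 * X1
      + ∑ k ∈ Ico 1 K, (L k * S y (n + k) ^ 3 / 2 - L k * S y (n + 1 + k) ^ 3 / 2
          + L k * S y (n + 1 + k) ^ 3 / 2 * (∑ q ∈ Ico 1 K, L q * S y (n + k + 1 + q) ^ 3 / 2 + (0:ℝ) * S y (n + k + 1) ^ 3 / 2))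
          * (1 / S' (S y (n + 1)) (k - 1) ^ 2 - 1 / S y (n + k) ^ 2)
      ≤ (∑ k ∈ Ico 1 K, L k * S y (n + 1 + k)) * S y (n + 1) ^ 2 * X1 := by
    rw [← sum_add_distrib, sum_mul, sum_mul]
    refine sum_le_sum fun k hk => ?_
    have hk1 : 1 ≤ k := (mem_Ico.mp hk).1
    by_cases hk2 : 2 ≤ k
    · obtain ⟨j, rfl⟩ : ∃ j, k = j + 1 := ⟨k - 1, by omega⟩
      simp only [Nat.add_sub_cancel]
      have hS0 : 0 ≤ 1 / S' (S y (n + 1)) j ^ 2 - 1 / S y (n + (j + 1)) ^ 2 := by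
        have hc := hcmp (n + 1) (by omega) j; rw [show n + 1 + j = n + (j + 1) by ring] at hc
        have hwp := ((hS' _ hq1.1 hq1.2).1 j).1
        exact sub_nonneg.mpr (one_div_le_one_div_of_le (pow_pos hwp 2) (pow_le_pow_left₀ hwp.le hc 2))
      have hSw : 1 / S' (S y (n + 1)) j ^ 2 - 1 / S y (n + (j + 1)) ^ 2 ≤ X1 * S y (n + 1) ^ 2 * ∑ l ∈ Ico 1 (j + 1), 1 / S y (n + 1 + l) ^ 2 := by
        have := hwin j; rwa [show n + 1 + j = n + (j + 1) by ring] at this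
      have hθ0 : 0 ≤ ∑ q ∈ Ico 1 K, L q * S y (n + (j + 1) + 1 + q) ^ 3 / 2 :=
        sum_nonneg fun q _ => by have := hL q; have := hpos (n + (j + 1) + 1 + q); positivity
      have hmain := flow_damped_age_ge_two_le_slack hmono hL hβ hlo hdom hh hf n hk2 hX10 hS0 hSw hθ0 le_rfl
      have hextra := defect_mod_le (B := B) (L := L) hL hβ hlo hh hf hME hMEγ n (k := j + 1) (by omega) hX10 hS0 hSw
      have e1 : (L (j + 1) * S y (n + (j + 1)) ^ 3 / 2 - L (j + 1) * S y (n + 1 + (j + 1)) ^ 3 / 2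
            + L (j + 1) * S y (n + 1 + (j + 1)) ^ 3 / 2 * (∑ q ∈ Ico 1 K, L q * S y (n + (j + 1) + 1 + q) ^ 3 / 2 + (0:ℝ) * S y (n + (j + 1) + 1) ^ 3 / 2))
            * (1 / S' (S y (n + 1)) j ^ 2 - 1 / S y (n + (j + 1)) ^ 2)
          = (L (j + 1) * S y (n + (j + 1)) ^ 3 / 2 - L (j + 1) * S y (n + 1 + (j + 1)) ^ 3 / 2
              + L (j + 1) * S y (n + 1 + (j + 1)) ^ 3 / 2 * (∑ q ∈ Ico 1 K, L q * S y (n + (j + 1) + 1 + q) ^ 3 / 2))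
              * (1 / S' (S y (n + 1)) j ^ 2 - 1 / S y (n + (j + 1)) ^ 2)
            + L (j + 1) * S y (n + 1 + (j + 1)) ^ 3 / 2 * ((0:ℝ) * S y (n + (j + 1) + 1) ^ 3 / 2)
              * (1 / S' (S y (n + 1)) j ^ 2 - 1 / S y (n + (j + 1)) ^ 2) := by ring
      rw [e1]
      linarith
    · have hk1' : k = 1 := by omega
      subst hk1'
      have hzero : 1 / S' (S y (n + 1)) (1 - 1) ^ 2 - 1 / S y (n + 1) ^ 2 = 0 := by
        rw [show (1 : ℕ) - 1 = 0 from rfl, family_zero hS' hq1.1 hq1.2]; ring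
      rw [hzero, mul_zero, add_zero]
      have := flow_age_one_le hmono hL hβ hlo hh hf n
      exact mul_le_mul_of_nonneg_right (by linarith) hX10
  -- the budget of the row
  have hbud : ∑ k ∈ Ico 1 K, L k * S y (n + 1 + k) ≤ 1 / S y (n + 1) ^ 2 - 1 / S y n ^ 2 := by
    refine le_trans ?_ (flow_budget_le hdom hh hf n)
    exact sum_le_sum_of_subset_of_nonneg (fun k hk => mem_range.mpr (mem_Ico.mp hk).2) fun k _ _ => mul_nonneg (hL k) (hpos _).le
  have hn2 : 0 < S y n ^ 2 := pow_pos (hpos n) 2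
  have hn12 : 0 < S y (n + 1) ^ 2 := pow_pos (hpos (n + 1)) 2
  have hstep : X1 * S y (n + 1) ^ 2 * (1 / S y n ^ 2) ≤ B' (S' (S y n)) - B (S (S y n)) := by
    have h1 : (∑ k ∈ Ico 1 K, L k * S y (n + 1 + k)) * S y (n + 1) ^ 2 * X1 ≤ (1 / S y (n + 1) ^ 2 - 1 / S y n ^ 2) * S y (n + 1) ^ 2 * X1 :=
      mul_le_mul_of_nonneg_right (mul_le_mul_of_nonneg_right hbud hn12.le) hX10
    have e0 : (1 / S y (n + 1) ^ 2 - 1 / S y n ^ 2) * S y (n + 1) ^ 2 = 1 - S y (n + 1) ^ 2 * (1 / S y n ^ 2) := by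
      rw [sub_mul, one_div_mul_cancel (ne_of_gt hn12), mul_comm]
    rw [e0] at h1
    have hF : (∑ k ∈ Ico 1 K, L k * S y (n + k) ^ 3 / 2) * X1 = ∑ k ∈ Ico 1 K, L k * S y (n + k) ^ 3 / 2 * X1 := by rw [sum_mul]
    nlinarith [hrow, hcost, h1, hF, hΔe]
  have e2 : X1 * S y (n + 1) ^ 2 * (1 / S y n ^ 2) * S y n ^ 2 = X1 * S y (n + 1) ^ 2 := by
    rw [mul_assoc, one_div_mul_cancel (ne_of_gt hn2), mul_one]
  have := mul_le_mul_of_nonneg_right hstep hn2.le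
  rw [e2] at this
  exact this

/-! ## §2 The nonlinear level gauge along every orbit -/

/-- **THE NONLINEAR LEVEL GAUGE FOR AN ISOTONE EXCESS OF SMALL MODULUS.**  `B u = β₀ + Σ_{k<K} L_k·u_k` (`β₀ > 0`, `L ≥ 0`, `L_0 = 0`); `B′ ≥ B` with modulus `M′`,
isotone excess of modulus `(0:ℝ)` with `(0:ℝ)·γ ≤ β₀∕5`; solution families `S`, `S′` (unique).  Along every base orbit `h = S y`, `y ∈ ]0,γ]`:  `X_m ≥ 0` and
`X_{m+1}·h_{m+1}² ≤ X_m·h_m²` at EVERY depth `m` (row induction from the deep region: (E118c) `exists_base_depth`, (E49j) `effective_le_of_small_pin`, (E119c)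
`base_gauge_mod`; step `gauge_step_mod`). [folklore] -/
theorem steps_nonneg_gauge_light (hBaff : ∀ u, SeqBox γ u → B u = β₀ + ∑ k ∈ range K, L k * u k) (hL : ∀ k, 0 ≤ L k) (hL0 : L 0 = 0) (hβ : 0 < β₀)
    (hB' : ∀ u u' : ℕ → ℝ, SeqBox γ u → SeqBox γ u' → ∀ D : ℝ, (∀ j, |u j - u' j| ≤ D) → |B' u - B' u'| ≤ M' * D) (hM' : 0 ≤ M')
    (hexc : ∀ u, SeqBox γ u → B u ≤ B' u)
    (hDmono : ∀ u v : ℕ → ℝ, SeqBox γ u → SeqBox γ v → (∀ j, u j ≤ v j) → B' u - B u ≤ B' v - B v)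
    (hS : ∀ p, 0 < p → p ≤ γ → SeqBox γ (S p) ∧ MemFlow B p (S p))
    (huniq : ∀ p, 0 < p → p ≤ γ → ∀ u u' : ℕ → ℝ, SeqBox γ u → SeqBox γ u' → MemFlow B p u → MemFlow B p u' → u = u')
    (hS' : ∀ p, 0 < p → p ≤ γ → SeqBox γ (S' p) ∧ MemFlow B' p (S' p))
    (huniq' : ∀ p, 0 < p → p ≤ γ → ∀ u u' : ℕ → ℝ, SeqBox γ u → SeqBox γ u' → MemFlow B' p u → MemFlow B' p u' → u = u')
    {y : ℝ} (hy : 0 < y) (hyγ : y ≤ γ) (hT : ∀ m, 2 ≤ m → ∑ k ∈ Ico 1 K, (k : ℝ) * (L k * S y (m + k) ^ 3 / 2) ≤ 1) :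
    ∀ m, 0 ≤ B' (S' (S y m)) - B (S (S y m))
      ∧ (B' (S' (S y (m + 1))) - B (S (S y (m + 1)))) * S y (m + 1) ^ 2 ≤ (B' (S' (S y m)) - B (S (S y m))) * S y m ^ 2 := by
  obtain ⟨hmono, hlo, hdom, hBmod⟩ := affine_facts hBaff hL hβ
  have hM : 0 ≤ ∑ k ∈ range K, L k := sum_nonneg fun k _ => hL k
  have hh := (hS y hy hyγ).1
  have hf := (hS y hy hyγ).2
  have hpos : ∀ j, 0 < S y j := fun j => (hh j).1
  -- the deep region
  obtain ⟨N₀, hN₀⟩ := exists_base_depth hBaff hL hβ hh hf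
  have hXdeep : ∀ m, N₀ ≤ m → 0 ≤ B' (S' (S y m)) - B (S (S y m)) := by
    intro m hm
    have hq := family_mem hS hy hyγ m
    have hsmall := (hN₀ m hm).2
    have := effective_le_of_small_pin hBmod hM hβ hlo hexc hDmono hq.1 hq.2 hsmall (hS _ hq.1 hq.2).1 (hS _ hq.1 hq.2).2
      (hS' _ hq.1 hq.2).1 (hS' _ hq.1 hq.2).2
    linarith
  -- P(n): non-negativity and the gauge at every m ≥ n
  have hP : ∀ d n, N₀ ≤ n + d → ∀ m, n ≤ m → 0 ≤ B' (S' (S y m)) - B (S (S y m))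
      ∧ (B' (S' (S y (m + 1))) - B (S (S y (m + 1)))) * S y (m + 1) ^ 2 ≤ (B' (S' (S y m)) - B (S (S y m))) * S y m ^ 2 := by
    intro d
    induction d with
    | zero =>
      intro n hn m hm
      rw [add_zero] at hn
      refine ⟨hXdeep m (hn.trans hm), ?_⟩
      exact base_gauge_light hBaff hL hL0 hβ hB' hM' hexc hDmono hS huniq hS' huniq' hy hyγ m (hN₀ m (hn.trans hm)).1
        (cmp_of_steps_nonneg hBaff hL hβ hB' hM' hexc hDmono hS huniq hS' huniq' hy hyγ m fun m' hm' => hXdeep m' (by omega))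
        fun m' hm' => hXdeep m' (by omega)
    | succ d ih =>
      intro n hn m hm
      have ih' := ih (n + 1) (by omega)
      by_cases hm1 : n + 1 ≤ m
      · exact ih' m hm1
      · have hmn : m = n := by omega
        subst hmn
        have hXb : ∀ m', m + 1 ≤ m' → 0 ≤ B' (S' (S y m')) - B (S (S y m')) := fun m' hm' => (ih' m' hm').1
        have hgb : ∀ m', m + 1 ≤ m' → (B' (S' (S y (m' + 1))) - B (S (S y (m' + 1)))) * S y (m' + 1) ^ 2
            ≤ (B' (S' (S y m')) - B (S (S y m'))) * S y m' ^ 2 := fun m' hm' => (ih' m' hm').2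
        have hgs := gauge_step_light hBaff hL hL0 hβ hB' hM' hexc hDmono hS huniq hS' huniq' hy hyγ m (fun m' hm' => hT m' (by omega)) hXb hgb
        refine ⟨?_, hgs⟩
        have h1 : 0 ≤ (B' (S' (S y (m + 1))) - B (S (S y (m + 1)))) * S y (m + 1) ^ 2 := mul_nonneg (hXb (m + 1) le_rfl) (sq_nonneg _)
        have h2 : 0 < S y m ^ 2 := pow_pos (hpos m) 2
        nlinarith
  intro m
  exact hP N₀ 0 (by omega) m (Nat.zero_le m)

/-! ## §3 Comparison at any size for every isotone excess, orbit light below -/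

/-- **THE EFFECTIVE β-FUNCTIONS OF `B` AND `B′` ARE ORDERED AT EVERY PIN**, `B(S y) ≤ B′(S′y)` for every `y ∈ ]0,γ]` — affine base of any profile and size, isotone
excess of any size with modulus `(0:ℝ)·γ ≤ β₀∕5`. [folklore] -/
theorem effective_le_light (hBaff : ∀ u, SeqBox γ u → B u = β₀ + ∑ k ∈ range K, L k * u k) (hL : ∀ k, 0 ≤ L k) (hL0 : L 0 = 0) (hβ : 0 < β₀)
    (hB' : ∀ u u' : ℕ → ℝ, SeqBox γ u → SeqBox γ u' → ∀ D : ℝ, (∀ j, |u j - u' j| ≤ D) → |B' u - B' u'| ≤ M' * D) (hM' : 0 ≤ M')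
    (hexc : ∀ u, SeqBox γ u → B u ≤ B' u)
    (hDmono : ∀ u v : ℕ → ℝ, SeqBox γ u → SeqBox γ v → (∀ j, u j ≤ v j) → B' u - B u ≤ B' v - B v)
    (hS : ∀ p, 0 < p → p ≤ γ → SeqBox γ (S p) ∧ MemFlow B p (S p))
    (huniq : ∀ p, 0 < p → p ≤ γ → ∀ u u' : ℕ → ℝ, SeqBox γ u → SeqBox γ u' → MemFlow B p u → MemFlow B p u' → u = u')
    (hS' : ∀ p, 0 < p → p ≤ γ → SeqBox γ (S' p) ∧ MemFlow B' p (S' p))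
    (huniq' : ∀ p, 0 < p → p ≤ γ → ∀ u u' : ℕ → ℝ, SeqBox γ u → SeqBox γ u' → MemFlow B' p u → MemFlow B' p u' → u = u') :
    ∀ y, 0 < y → y ≤ γ → (∀ m, 2 ≤ m → ∑ k ∈ Ico 1 K, (k : ℝ) * (L k * S y (m + k) ^ 3 / 2) ≤ 1) → B (S y) ≤ B' (S' y) := by
  intro y hy hyγ hT
  have := (steps_nonneg_gauge_light hBaff hL hL0 hβ hB' hM' hexc hDmono hS huniq hS' huniq' hy hyγ hT 0).1
  rw [family_zero hS hy hyγ] at this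
  linarith

/-- **COMPARISON AT ANY SIZE FOR EVERY ISOTONE EXCESS OF SMALL MODULUS (conjecture (E58′) under `(0:ℝ)·γ ≤ β₀∕5`), family-free form.**  `B u = β₀ + Σ_{k<K} L_k·u_k` on
the box ]0,γ] with `β₀ > 0`, `L ≥ 0`, `L_0 = 0` — the profile, the range `K` and ALL SIZES ARBITRARY; `B′ ≥ B` on the box with a modulus `M′ ≥ 0`, the excess `B′ − B`
ISOTONE and with modulus `(0:ℝ) ≥ 0` along ordered pairs, `(0:ℝ)·γ ≤ β₀∕5` (its size free); `h`, `h′` ANY box solutions of `B`, `B′` from one pin `p ∈ ]0,γ]`.  Then `h′ ≤ h`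
at EVERY scale.  ((E39) existence and (E43b) uniqueness at any size, `effective_le_mod`, (E49k) `family_le_of_orbit`.) [folklore] -/
theorem le_of_isotone_excess_light {p : ℝ} {h h' : ℕ → ℝ} (hBaff : ∀ u, SeqBox γ u → B u = β₀ + ∑ k ∈ range K, L k * u k) (hL : ∀ k, 0 ≤ L k)
    (hL0 : L 0 = 0) (hβ : 0 < β₀)
    (hB' : ∀ u u' : ℕ → ℝ, SeqBox γ u → SeqBox γ u' → ∀ D : ℝ, (∀ j, |u j - u' j| ≤ D) → |B' u - B' u'| ≤ M' * D) (hM' : 0 ≤ M')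
    (hexc : ∀ u, SeqBox γ u → B u ≤ B' u)
    (hDmono : ∀ u v : ℕ → ℝ, SeqBox γ u → SeqBox γ v → (∀ j, u j ≤ v j) → B' u - B u ≤ B' v - B v)
    (hp : 0 < p) (hpγ : p ≤ γ) (hh : SeqBox γ h) (hf : MemFlow B p h) (hh' : SeqBox γ h') (hf' : MemFlow B' p h')
    (hT : ∀ m, 2 ≤ m → ∑ k ∈ Ico 1 K, (k : ℝ) * (L k * h (m + k) ^ 3 / 2) ≤ 1) (j : ℕ) :
    h' j ≤ h j := by
  obtain ⟨hmono', hlo'⟩ := excess_facts hBaff hL hβ hexc hDmono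
  obtain ⟨hmono, hlo, _, hBmod⟩ := affine_facts hBaff hL hβ
  have hM : 0 ≤ ∑ k ∈ range K, L k := sum_nonneg fun k _ => hL k
  have hγ : 0 < γ := hp.trans_le hpγ
  have hex : ∀ q : ℝ, 0 < q → q ≤ γ → ∃ k : ℕ → ℝ, SeqBox γ k ∧ MemFlow B q k := fun q hq hqγ => exists_memFlow_zm hBmod hM hq hqγ hβ hlo
  have hex' : ∀ q : ℝ, 0 < q → q ≤ γ → ∃ k : ℕ → ℝ, SeqBox γ k ∧ MemFlow B' q k := fun q hq hqγ => exists_memFlow_zm hB' hM' hq hqγ hβ hlo'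
  choose! S hSb hSf using hex
  choose! S' hS'b hS'f using hex'
  have hS : ∀ q, 0 < q → q ≤ γ → SeqBox γ (S q) ∧ MemFlow B q (S q) := fun q hq hqγ => ⟨hSb q hq hqγ, hSf q hq hqγ⟩
  have hS' : ∀ q, 0 < q → q ≤ γ → SeqBox γ (S' q) ∧ MemFlow B' q (S' q) := fun q hq hqγ => ⟨hS'b q hq hqγ, hS'f q hq hqγ⟩
  have huniq : ∀ q, 0 < q → q ≤ γ → ∀ u u' : ℕ → ℝ, SeqBox γ u → SeqBox γ u' → MemFlow B q u → MemFlow B q u' → u = u' :=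
    fun q hq _ u u' hu hu' hfu hfu' => memFlow_unique_of_monotone_zm hmono hBmod hM hq hβ hlo hu hu' hfu hfu'
  have huniq' : ∀ q, 0 < q → q ≤ γ → ∀ u u' : ℕ → ℝ, SeqBox γ u → SeqBox γ u' → MemFlow B' q u → MemFlow B' q u' → u = u' :=
    fun q hq _ u u' hu hu' hfu hfu' => memFlow_unique_of_monotone_zm hmono' hB' hM' hq hβ hlo' hu hu' hfu hfu'
  have e : h = S p := huniq p hp hpγ _ _ hh (hS p hp hpγ).1 hf (hS p hp hpγ).2
  have e' : h' = S' p := huniq' p hp hpγ _ _ hh' (hS' p hp hpγ).1 hf' (hS' p hp hpγ).2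
  have hTS : ∀ m, 2 ≤ m → ∑ k ∈ Ico 1 K, (k : ℝ) * (L k * S p (m + k) ^ 3 / 2) ≤ 1 := by rw [← e]; exact hT
  have hsteps := steps_nonneg_gauge_light hBaff hL hL0 hβ hB' hM' hexc hDmono hS huniq hS' huniq' hp hpγ hTS
  rw [e, e']
  exact family_le_of_orbit hβ hγ hB' hM' hlo' hS huniq hS' huniq' ⟨hp, hpγ⟩ (fun i _ => by linarith [(hsteps i).1]) j

end Summit.QuantumFields.BalabanUV.Beta.EriceRemainderEnclosureHistoryAutonomyComparisonNonlinearLight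

end
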